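import Summits.BirchSwinnertonDyer.Rank1Residual.X2.TwistTamagawa
import Summits.BirchSwinnertonDyer.Rank1Residual.X11b.Three.TamagawaTwistAnyDiscr
import Literature.NumberTheory.EllipticCurves.QuadraticTwistLocalDataAtTwoHoldsProofs
import Literature.NumberTheory.EllipticCurves.CuspFormLFunctionLevelConductorProofs
import HarnessLib
import HarnessLib.Audit.Tags

/-!
# The Heegner-twist Tamagawa symmetry at `3` for ANY field discriminant:
# `ord₃ ∏_ℓ c_ℓ(G^{(d_K)}) = ord₃ ∏_ℓ c_ℓ(G)`, `d_K` odd OR even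

HONEST FRAMING (cell `b2b-bsdres`, run/shared/lean/b2b/bsd-rank1-residual/, verbatim in every file): the
goal of the cell is to DELETE the COMBINATION-SHAPED residual classes of the Birch–Swinnerton-Dyer formula
for ALL analytic-rank `≤ 1` elliptic curves over `ℚ` — "full BSD formula for every rank `≤ 1` curve in
class `C`" assembled STRICTLY from published theorems — so that the rank-`≤ 1` remainder becomes exactly
the CONSTRUCTION-SHAPED classes, which are TYPED (missing-input `Prop`s), NOT attempted. This is not
"finishing BSD". Team O5 / lane CLASS-CLOSURE; RESEARCH ROUTE; THEOREMS ONLY (bookkeeping over tree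
theorems): no definition, no named fact, no `@[conjecture]` node; NOTHING is booked and no mark of
`RESIDUAL-MAP.md` moves; O5 stays OPEN. Unit `b2b-bsdres-harvest-2` (on-call harvest seat) GEN 59, item
E116′ = o5-r2 GEN 22/23's re-scoped ask (HOME/INBOX.md l.14240, l.14309 "the ANY-`d_K` Tamagawa symmetry at
`3` … EXACTLY the piece the tree lacks", l.14380 (3) A-O5-G23-3).

## What this file proves

The O5 (t′) END of record (`O5/HeegnerLogTransportThreeResidualEnd.lean` and its successors, parts
15–18 of o5-r2 / cc-typer-5) displays a per-row binder `htamGd : 3 ∤ ∏_ℓ c_ℓ(G_d)` for the twist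
`G_d = C • G^{(d_K)}` of the good-ordinary companion `G` by the Heegner field `K`; o5-r2 GEN 23's part 18
reduces it to `htamGd' : Even d_K → 3 ∤ ∏c(G_d)` because the tree's transport
`X2.padicValNat_tamagawaProduct_twist_of_heegner_of_odd` (eisenstein-p2) asks `d_K` odd: at an even `d_K`
the one local number it could not control is `c₂(G^{(d_K)})` for `G` GOOD at `2` — x11b3-p8's displayed
"binder at `2`" of `X11b/Three/TamagawaTwistAnyDiscr.lean` ("a tree proof would be Tate's algorithm at
`2` for ramified quadratic twists of good fibres; not attempted here").

That Tate-algorithm run IS in the tree since 2026-08-22: Barrios–Roy–Sahajpal–Tallana–Tobin–Wiersema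
2025, Thm. 5.1 (rows `R = I₀` of the two `ℚ₂` tables) is vendored AND DISCHARGED
(`BarriosEtAl2025.localTamagawaNumber_quadraticTwist_two_mem_of_goodReduction_holds`,
`Literature/…/QuadraticTwistLocalDataAtTwoHoldsProofs.lean`): for `G/ℚ` good at `2` and ANY `d ≠ 0`,
`c₂(C • G^{(d)}) ∈ {1, 2, 4}` (types `I₀, I₄*, I₈*, II, II*`). This file cashes it:

* §1 `not_three_dvd_localTamagawaNumber_two_twist_of_good` — `3 ∤ c₂(G_d)` for `G` good at `2`, any
  `d ≠ 0` (the binder at `2`, now a theorem);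
* §2 `padicValNat_localTamagawaNumber_twist_eq_three_of_heegner` — prime by prime,
  `ord₃ c_ℓ(G_d) = ord₃ c_ℓ(G)` for `K` imaginary quadratic Heegner for `N_G` with `3 ∤ d_K` and ANY
  parity of `d_K`: `ℓ ∣ N_G` — `d_K ∈ (ℚ_ℓ^×)²`, the curves are `ℚ_ℓ`-isomorphic (X2's branch verbatim);
  `ℓ ∤ N_G` (`c_ℓ(G) = 1`): `ℓ = 2 ∣ d_K` — §1; odd `ℓ ∣ d_K` — `ℓ ≠ 3`, so `ℓ ≥ 5`, `ℓ ∥ d_K`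
  (`Quadratic.not_sq_dvd_discr_of_prime_ne_two`), type `I₀*`, `ord₃ c = 0`
  (`X2.padicValNat_localTamagawaNumber_twist_of_dvd`); `ℓ = 2 ∤ d_K` — `d_K ≡ 1 (4)`, `c = 1`
  (`X2.localTamagawaNumber_twist_of_not_dvd`); odd `ℓ ∤ N_G d_K` — good reduction survives
  (`X11b.hasGoodReductionAtPrime_twist_of_odd_of_not_dvd`), `c = 1`;
* §3 `padicValNat_tamagawaProduct_twist_of_heegner_three` — **the E116′ target, o5-r2's verbatim
  signature (l.14309)**: `X2.padicValNat_tamagawaProduct_twist_of_heegner_of_odd` at `p = 3` with `hodd`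
  DELETED; and `not_three_dvd_tamagawaProduct_twist_of_heegner_anyDiscr` — part 18 v2's
  `not_three_dvd_tamagawaProduct_twist_of_heegner` with the binder `htamGd'` DELETED (same remaining
  binders, same order), i.e. the 1-line substitution that makes the END's `htamGd'` disappear (o5-r2's
  "part 20", or harvest-2's END corollary once part 18 is in the tree).

Nothing here is specific to `p = 3` beyond `3 ∤ d_K` and `3 ∤ 1, 2, 4`; nothing is booked.

References: A. J. Barrios, M. Roy, N. Sahajpal, D. Tallana, B. Tobin, H. Wiersema, Res. Number Theory 11
(2025), Thm. 5.1, §5 tables rows `I₀` [BarriosEtAl2025]; D. Jetchev, C. Skinner, X. Wan, Camb. J. Math.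
5 (2017) §7.3.1 (eq:tamK), §7.4.1 [JetchevSkinnerWan2017]; J. H. Silverman, *ATAEC* IV.9 Table 4.1,
Cor. IV.9.2(d) [SilvermanATAEC1994]; *AEC* VII.1 Prop. 1.3(b), VII.5 Prop. 5.1(a), Cor. VII.6.2
[SilvermanAEC2009]; HOME/INBOX.md l.14240–14242, l.14309, l.14380.
-/

set_option autoImplicit false

noncomputable section

open scoped Classical

namespace Summit.BirchSwinnertonDyer.Rank1Residual.O5.TwistTamagawa

open WeierstrassCurve NumberField IsDedekindDomain Rat.HeightOneSpectrum
  Literature.NumberTheory.EllipticCurves Literature.NumberTheory.EllipticCurves.ModularForms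
  Literature.NumberTheory.EllipticCurves.Rank1Residual

/-! ## §1 The binder at `2` is a theorem -/

/-- **`3 ∤ c₂(G_d)` for `G/ℚ` good at `2` and ANY twist parameter `d ≠ 0`**, `G_d = C_d • G^{(d)}` any
equation of the twist: by Barrios et al. 2025 Thm. 5.1 (rows `I₀`; tree theorem
`BarriosEtAl2025.localTamagawaNumber_quadraticTwist_two_mem_of_goodReduction_holds`) `c₂(G_d) ∈ {1, 2, 4}`.
[cite: BarriosEtAl2025, Thm. 5.1 with the rows R = I₀ of the §5 tables (v(d) = 0, 1)] -/
theorem not_three_dvd_localTamagawaNumber_two_twist_of_good (G : WeierstrassCurve ℚ) [G.IsElliptic]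
    (hgood : G.HasGoodReductionAtPrime 2) {d : ℚ} (hd : d ≠ 0) {Gd : WeierstrassCurve ℚ}
    [Gd.IsElliptic] (Cd : VariableChange ℚ) (hGd : Cd • G.quadraticTwist d = Gd) :
    ¬ 3 ∣ (Gd.baseChange ℚ_[2]).localTamagawaNumber ℤ_[2] := by
  have hmem : (Gd.baseChange ℚ_[2]).localTamagawaNumber ℤ_[2] ∈ ({1, 2, 4} : Set ℕ) :=
    BarriosEtAl2025.localTamagawaNumber_quadraticTwist_two_mem_of_goodReduction_holds G hgood d hd Gd
      Cd hGd
  simp only [Set.mem_insert_iff, Set.mem_singleton_iff] at hmem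
  rcases hmem with hc | hc | hc <;> rw [hc] <;> decide

/-! ## §2 Prime by prime, any `d_K` -/

/-- **`ord₃ c_ℓ(G^{(d_K)}) = ord₃ c_ℓ(G)` at every prime `ℓ`, for ANY parity of `d_K`**, `K` imaginary
quadratic with `3 ∤ d_K` in which every prime of the conductor `N_G` of the globally minimal `G` splits,
`G_d = C_d • G^{(d_K)}` any equation of the twist. `ℓ ∣ N_G`: `d_K ∈ (ℚ_ℓ^×)²`
(`X11b.isSquare_discr_padic_of_heegner`), `G_d ⊗ ℚ_ℓ ≅ G ⊗ ℚ_ℓ`, `c_ℓ(G_d) = c_ℓ(G)`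
(`localTamagawaNumber_variableChange_holds`). `ℓ ∤ N_G` (`c_ℓ(G) = 1`): `2 = ℓ ∣ d_K` — §1 (Barrios et
al.); odd `ℓ ∣ d_K` — `ℓ ≥ 5`, `ℓ ∥ d_K`, `I₀*` (`X2.padicValNat_localTamagawaNumber_twist_of_dvd`);
`2 = ℓ ∤ d_K` — `d_K = 4k + 1`, `c = 1` (`X2.localTamagawaNumber_twist_of_not_dvd`); odd `ℓ ∤ N_G d_K` —
good reduction survives (`X11b.hasGoodReductionAtPrime_twist_of_odd_of_not_dvd`), `c = 1`. X2's
`padicValNat_localTamagawaNumber_twist_eq_of_odd` at `p = 3` with `hodd` deleted.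
[cite: JetchevSkinnerWan2017, §7.4.1 (eq:tamK)] [cite: BarriosEtAl2025, Thm. 5.1, §5 tables rows I₀]
[cite: SilvermanATAEC1994, IV.9.4 Table 4.1 and Cor. IV.9.2(d)] [cite: SilvermanAEC2009, VII.1 Prop. 1.3(b), VII.5 Prop. 5.1(a)] -/
theorem padicValNat_localTamagawaNumber_twist_eq_three_of_heegner (G : WeierstrassCurve ℚ)
    [G.IsElliptic] [G.IsGloballyMinimal] (K : Type) [Field K] [NumberField K]
    (hK : IsImaginaryQuadratic K) (hH : SatisfiesHeegnerHypothesis (G.conductorNorm ℤ) K)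
    (h3d : ¬ (3 : ℤ) ∣ NumberField.discr K) {Gd : WeierstrassCurve ℚ} [Gd.IsElliptic]
    (Cd : VariableChange ℚ) (hGd : Cd • G.quadraticTwist (NumberField.discr K : ℚ) = Gd) (ℓ : ℕ)
    [Fact ℓ.Prime] :
    padicValNat 3 ((Gd.baseChange ℚ_[ℓ]).localTamagawaNumber ℤ_[ℓ]) =
      padicValNat 3 ((G.baseChange ℚ_[ℓ]).localTamagawaNumber ℤ_[ℓ]) := by
  haveI : Fact (Nat.Prime 3) := ⟨Nat.prime_three⟩
  have hℓP : ℓ.Prime := Fact.out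
  set d : ℤ := NumberField.discr K with hd_def
  have hdZ : d ≠ 0 := NumberField.discr_ne_zero K
  have hD0 : (d : ℚ) ≠ 0 := by exact_mod_cast hdZ
  haveI : (G.baseChange ℚ_[ℓ]).IsElliptic :=
    inferInstanceAs (G.map (algebraMap ℚ ℚ_[ℓ])).IsElliptic
  haveI : (Gd.baseChange ℚ_[ℓ]).IsElliptic :=
    inferInstanceAs (Gd.map (algebraMap ℚ ℚ_[ℓ])).IsElliptic
  haveI : (G.quadraticTwist (d : ℚ)).IsElliptic := G.isElliptic_quadraticTwist hD0
  by_cases hℓN : ℓ ∣ G.conductorNorm ℤ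
  · -- `ℓ ∣ N_G`: `d_K` is a square in `ℚ_ℓ`, the two curves are `ℚ_ℓ`-isomorphic (X2 verbatim)
    obtain ⟨θ, hθ⟩ := X11b.isSquare_discr_padic_of_heegner K hK hH ℓ hℓN
    have hθ0 : θ ≠ 0 := by
      rintro rfl
      exact (map_ne_zero (algebraMap ℚ ℚ_[ℓ])).mpr hD0 (hθ.trans (mul_zero 0))
    obtain ⟨C, hC⟩ := (G.baseChange ℚ_[ℓ]).exists_variableChange_smul_eq_quadraticTwist_sq hθ0
    have h1 : (G.quadraticTwist (d : ℚ)).baseChange ℚ_[ℓ] = C • G.baseChange ℚ_[ℓ] := by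
      rw [hC, baseChange, baseChange, map_quadraticTwist, hθ, sq]
    have hYX : Gd.baseChange ℚ_[ℓ] = (Cd.map (algebraMap ℚ ℚ_[ℓ]) * C) • G.baseChange ℚ_[ℓ] := by
      rw [← hGd, WeierstrassCurve.VariableChange.baseChange_smul_eq (G.quadraticTwist (d : ℚ)) Cd ℚ_[ℓ],
        h1, mul_smul]
    rw [hYX, localTamagawaNumber_variableChange_holds ℤ_[ℓ] (G.baseChange ℚ_[ℓ])
      (Cd.map (algebraMap ℚ ℚ_[ℓ]) * C)]
  · -- `ℓ ∤ N_G`: `G` is good at `ℓ`, `c_ℓ(G) = 1`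
    have hgood : G.HasGoodReductionAtPrime ℓ := by
      by_contra h
      exact hℓN ((G.dvd_conductorNorm_iff_not_hasGoodReductionAtPrime ℓ).mpr h)
    have hcG : (G.baseChange ℚ_[ℓ]).localTamagawaNumber ℤ_[ℓ] = 1 := by
      haveI : ((G.baseChange ℚ_[ℓ]).minimal ℤ_[ℓ]).HasGoodReduction ℤ_[ℓ] := hgood
      exact localTamagawaNumber_eq_one_of_hasGoodReduction_holds ℤ_[ℓ] _
    rw [hcG, padicValNat_one_right]
    by_cases hℓd : (ℓ : ℤ) ∣ d
    · by_cases hℓ2 : ℓ = 2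
      · -- `2 ∣ d_K`, `G` good at `2`: the binder at `2` (§1, Barrios et al. 2025)
        subst hℓ2
        exact padicValNat.eq_zero_of_not_dvd
          (not_three_dvd_localTamagawaNumber_two_twist_of_good G hgood hD0 Cd hGd)
      · -- an odd ramified good prime: `ℓ ≠ 3` (`3 ∤ d_K`), so `ℓ ≥ 5`, `ℓ ∥ d_K`, type `I₀*`
        have hℓ3 : ℓ ≠ 3 := by
          rintro rfl
          exact h3d hℓd
        have hℓ5 : 5 ≤ ℓ := by
          have h2 := hℓP.two_le
          by_contra hlt
          interval_cases ℓ
          · exact hℓ2 rfl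
          · exact hℓ3 rfl
          · exact absurd hℓP (by decide)
        have hsq : ¬ (ℓ : ℤ) ^ 2 ∣ d :=
          Literature.NumberTheory.QuadraticFields.Quadratic.not_sq_dvd_discr_of_prime_ne_two hK.1 hℓP
            hℓ2
        exact X2.padicValNat_localTamagawaNumber_twist_of_dvd G 3 (by decide) ℓ hℓ5 hdZ hℓd hsq hgood
          Cd hGd
    · by_cases hℓ2 : ℓ = 2
      · -- `2 ∤ d_K`: an odd field discriminant is `≡ 1 (mod 4)`, good reduction persists, `c = 1`
        subst hℓ2
        have h1 : d % 4 = 1 := by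
          rcases Literature.NumberTheory.QuadraticFields.Quadratic.isFundamentalDiscriminant_discr
            (K := K) hK.1 with ⟨h, -, -⟩ | ⟨h4, -, -⟩
          · exact h
          · exact absurd (dvd_trans (by norm_num : (2 : ℤ) ∣ 4) h4) (by exact_mod_cast hℓd)
        have hdk : d = 4 * (d / 4) + 1 := by omega
        rw [X2.localTamagawaNumber_twist_of_not_dvd G 2 hdk (by exact_mod_cast hℓd) hgood Cd hGd,
          padicValNat_one_right]
      · -- an odd unramified good prime: good reduction survives the twist, `c = 1`
        have hgoodd : Gd.HasGoodReductionAtPrime ℓ :=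
          X11b.hasGoodReductionAtPrime_twist_of_odd_of_not_dvd G K Cd hGd ℓ hℓ2 hℓd hgood
        haveI : ((Gd.baseChange ℚ_[ℓ]).minimal ℤ_[ℓ]).HasGoodReduction ℤ_[ℓ] := hgoodd
        rw [localTamagawaNumber_eq_one_of_hasGoodReduction_holds ℤ_[ℓ] _, padicValNat_one_right]

/-! ## §3 The Tamagawa symmetry at `3`, any `d_K` -/

/-- `ord_p` of a finite product of non-zero naturals is the sum of the `ord_p`. [folklore] -/
private theorem padicValNat_finset_prod_three (p : ℕ) [Fact p.Prime] {ι : Type*} (s : Finset ι)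
    (f : ι → ℕ) (hf : ∀ i ∈ s, f i ≠ 0) :
    padicValNat p (∏ i ∈ s, f i) = ∑ i ∈ s, padicValNat p (f i) := by
  induction s using Finset.induction_on with
  | empty => simp
  | insert a s ha ih =>
    rw [Finset.prod_insert ha, Finset.sum_insert ha,
      padicValNat.mul (hf a (Finset.mem_insert_self a s))
        (Finset.prod_ne_zero_iff.mpr fun i hi => hf i (Finset.mem_insert_of_mem hi)),
      ih fun i hi => hf i (Finset.mem_insert_of_mem hi)]

/-- **E116′ — the Heegner-twist Tamagawa symmetry at `3` for ANY field discriminant: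
`ord₃ ∏_ℓ c_ℓ(G_d) = ord₃ ∏_ℓ c_ℓ(G)`** for `G` globally minimal, `K` imaginary quadratic satisfying the
Heegner hypothesis for `N_G` with `3 ∤ d_K` (e.g. `3` split in `K`), and ANY equation
`G_d = C_d • G^{(d_K)}` of the twist — `d_K` odd or even. Both Tamagawa products are finite products of
local Tamagawa numbers over the union of the bad places (`tamagawaProduct_eq_prod`), compared prime by
prime (§2). This is eisenstein-p2's `X2.padicValNat_tamagawaProduct_twist_of_heegner_of_odd` at `p = 3`
with the hypothesis `Odd d_K` DELETED (o5-r2 GEN 23's requested signature, HOME/INBOX.md l.14309).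
[cite: JetchevSkinnerWan2017, §7.3.1 (eq:tamK) and §7.4.1 (pp. 29–31)] [cite: BarriosEtAl2025, Thm. 5.1, §5 tables rows I₀]
[cite: SilvermanATAEC1994, Cor. IV.9.2(d) and Table 4.1] -/
theorem padicValNat_tamagawaProduct_twist_of_heegner_three (G Gd : WeierstrassCurve ℚ) [G.IsElliptic]
    [G.IsGloballyMinimal] [Gd.IsElliptic] (K : Type) [Field K] [NumberField K]
    (hK : IsImaginaryQuadratic K) (hH : SatisfiesHeegnerHypothesis (G.conductorNorm ℤ) K)
    (h3d : ¬ (3 : ℤ) ∣ NumberField.discr K) (Cd : VariableChange ℚ)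
    (hGd : Cd • G.quadraticTwist (NumberField.discr K : ℚ) = Gd) :
    padicValNat 3 Gd.tamagawaProduct = padicValNat 3 G.tamagawaProduct := by
  haveI : Fact (Nat.Prime 3) := ⟨Nat.prime_three⟩
  have hfG : (G.badPlaces ℤ).Finite := G.finite_badPlaces_holds ℤ
  have hfGd : (Gd.badPlaces ℤ).Finite := Gd.finite_badPlaces_holds ℤ
  set s : Finset (IsDedekindDomain.HeightOneSpectrum ℤ) := hfG.toFinset ∪ hfGd.toFinset with hs
  have hsG : ∀ v, ¬ G.HasGoodReductionAt v → v ∈ s := fun v hv ↦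
    Finset.mem_union_left _ (by rw [Set.Finite.mem_toFinset, mem_badPlaces_iff]; exact hv)
  have hsGd : ∀ v, ¬ Gd.HasGoodReductionAt v → v ∈ s := fun v hv ↦
    Finset.mem_union_right _ (by rw [Set.Finite.mem_toFinset, mem_badPlaces_iff]; exact hv)
  rw [tamagawaProduct_eq_prod G s hsG, tamagawaProduct_eq_prod Gd s hsGd,
    padicValNat_finset_prod_three 3 s _ fun v _ ↦ ?_,
    padicValNat_finset_prod_three 3 s _ fun v _ ↦ ?_]
  · refine Finset.sum_congr rfl fun v _ ↦ ?_
    haveI := Fact.mk (primesEquiv v).2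
    exact padicValNat_localTamagawaNumber_twist_eq_three_of_heegner G K hK hH h3d Cd hGd (primesEquiv v)
  · haveI := Fact.mk (primesEquiv v).2
    haveI : (Gd.baseChange ℚ_[primesEquiv v]).IsElliptic :=
      inferInstanceAs (Gd.map (algebraMap ℚ ℚ_[primesEquiv v])).IsElliptic
    exact localTamagawaNumber_padic_ne_zero_holds (primesEquiv v) _
  · haveI := Fact.mk (primesEquiv v).2
    haveI : (G.baseChange ℚ_[primesEquiv v]).IsElliptic :=
      inferInstanceAs (G.map (algebraMap ℚ ℚ_[primesEquiv v])).IsElliptic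
    exact localTamagawaNumber_padic_ne_zero_holds (primesEquiv v) _

/-- **`3 ∤ ∏c(G) ⟹ 3 ∤ ∏c(G_d)`, any `d_K`** (the conductor-currency form): under the hypotheses of
`padicValNat_tamagawaProduct_twist_of_heegner_three`, Tamagawa products being positive
(`tamagawaProduct_pos'`). [cite: JetchevSkinnerWan2017, §7.3.1 (eq:tamK)] [cite: SilvermanAEC2009, Cor. VII.6.2] -/
theorem not_three_dvd_tamagawaProduct_twist_of_heegner_three (G Gd : WeierstrassCurve ℚ)
    [G.IsElliptic] [G.IsGloballyMinimal] [Gd.IsElliptic] (K : Type) [Field K] [NumberField K]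
    (hK : IsImaginaryQuadratic K) (hH : SatisfiesHeegnerHypothesis (G.conductorNorm ℤ) K)
    (h3d : ¬ (3 : ℤ) ∣ NumberField.discr K)
    (hGd : ∃ C : VariableChange ℚ, C • G.quadraticTwist (NumberField.discr K : ℚ) = Gd)
    (htamG : ¬ 3 ∣ G.tamagawaProduct) : ¬ 3 ∣ Gd.tamagawaProduct := by
  haveI : Fact (Nat.Prime 3) := ⟨Nat.prime_three⟩
  obtain ⟨Cd, hCd⟩ := hGd
  have hv : padicValNat 3 Gd.tamagawaProduct = padicValNat 3 G.tamagawaProduct :=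
    padicValNat_tamagawaProduct_twist_of_heegner_three G Gd K hK hH h3d Cd hCd
  intro h3
  exact (dvd_iff_padicValNat_ne_zero Gd.tamagawaProduct_pos'.ne').mp h3
    (hv.trans (padicValNat.eq_zero_of_not_dvd htamG))

/-- **The END's binder `htamGd'` is redundant for EVERY `d_K`** — o5-r2 GEN 23's part-18
`HeegnerLogTransport.not_three_dvd_tamagawaProduct_twist_of_heegner` with `htamGd'` DELETED, same
remaining binders in the same order (so the END's call site changes by dropping one argument): for the
good-ordinary companion `G` (globally minimal) with a modular parametrisation of level `N′` (`N′ = N_G`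
by Carayol from modularity, `IsNewformOf.level_eq_conductorNorm_of_exists_isNewformOf`), `K` imaginary
quadratic Heegner for `N′` with `3` split in `K` (`3 ∤ d_K`, `not_dvd_discr_of_split`), and any model
`G_d` of `G^{(d_K)}`: `3 ∤ ∏c(G) ⟹ 3 ∤ ∏c(G_d)`. [cite: JetchevSkinnerWan2017, §7.4.1 (eq:tamK) (pp. 29–31)]
[cite: BarriosEtAl2025, Thm. 5.1, §5 tables rows I₀] [cite: DiamondShurman2005, Thm. 8.8.1] -/
theorem not_three_dvd_tamagawaProduct_twist_of_heegner_anyDiscr (hmod : exists_isNewformOf)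
    (G Gd : WeierstrassCurve ℚ) [G.IsElliptic] [G.IsGloballyMinimal] [Gd.IsElliptic]
    {N' : ℕ} [NeZero N'] (D' : ModularParametrizationData G N')
    (K : Type) [Field K] [NumberField K] (hK : IsImaginaryQuadratic K)
    (hH' : SatisfiesHeegnerHypothesis N' K) (h3K : SatisfiesHeegnerHypothesis 3 K)
    (hGd : ∃ C : VariableChange ℚ, C • G.quadraticTwist (NumberField.discr K : ℚ) = Gd)
    (htamG : ¬ 3 ∣ G.tamagawaProduct) : ¬ 3 ∣ Gd.tamagawaProduct := by
  have h3d : ¬ ((3 : ℤ) ∣ NumberField.discr K) :=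
    not_dvd_discr_of_split hK Nat.prime_three (by decide) h3K
  have hN' : N' = G.conductorNorm ℤ :=
    IsNewformOf.level_eq_conductorNorm_of_exists_isNewformOf hmod D'.isNewformOf
  exact not_three_dvd_tamagawaProduct_twist_of_heegner_three G Gd K hK (hN' ▸ hH') h3d hGd htamG

end Summit.BirchSwinnertonDyer.Rank1Residual.O5.TwistTamagawa

end
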